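import Summits.QuantumFields.YangMills.Theorems.BalabanUVNodesN22AtRecordOfGenAnalyticNonexpansive
import Summits.QuantumFields.BalabanUV.T4Continuum.Spine.NE1p.DressedOutputAnalyticFaces

/-!
# BalabanUVNodes ∕ node N22 = NE9 — THE ANALYTIC READING ONE LAYER DOWN: the term-level analyticity binders (AR-fact)∕(AR-holo)∕ball bound of modules J57–J65 on
# node00-def-W1's one-step map FOLLOW from an analytic reading of the step's ACTIVITIES (2.11)∕(2.14) — [II] p. 15 «the activities in (2.13), and the whole sum
# E^{(k+1)}(X), are analytic functions …» + (2.39)–(2.41) p. 21 BY NAME (Kotecký–Preiss holomorphy in a Banach parameter on the four-torus, S25); ROAD 2 at the record from it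

Cell `pub-ymgap`, HUMAN RULING D-0062 (Track A), R134 seat `pub-ymgap-dag-n22-c` (strategy s1: «the history-Lipschitz estimate (2.40)–(2.41) p. 21 of [II] on the W1 object»), generation
18, module J66.  THEOREMS ONLY (no `def`, no `sorry`, standard axioms); `--kind proof --supports stmt-QuantumFields-27366 --as helper` (K3⁸ `SpineGivenEndpointR13SepCoPHV`), COUNT-NEUTRAL.
Imports module J63 `…N22AtRecordOfGenAnalyticNonexpansive` (ROAD 2 non-expansive at the record; through it J57–J62, def-W1's generator) and S25 `Spine/NE1p/DressedOutputAnalyticFaces`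
(`analytic_and_bounded_locE_param_torus`: holomorphy of `p ↦ locE(H_p)(X)` in ANY complex normed parameter + the (1.18)-type bound on the four-torus, located numerals — the module
generation 0 ∕ 2–5 of this lane used for the STRIP; here at a BANACH parameter).  Nothing re-declared.

WHY (the seat's row, one layer down).  Modules J57–J65 display the analytic reading (AR) of the (2.13) TERM map `old ↦ (G k).E t old φ X` (factorization through a reading
`ρ k : OlderTerms → Pot k`, holomorphy and the bound `M_b e^{−κd}` on a ball with margin).  def-W1's `(G k).E` IS the tree's Kotecký–Preiss literal `locE` of the step's ACTIVITIES
`Z ↦ (G k).H t old φ Z` (`stepGenE_eq_locE`, `rfl` on the family's four-torus).  So the term-level binders follow from the same binders ONE LAYER DOWN, on the activities — the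
(2.38)∕(2.40)–(2.41) layer of the seat's row: (ARH-fact) `(G k).H t old φ Z = Ah k t φ Z (ρ k old)` on `Adm k` for the polymers `Z ⊆ X`; (ARH-holo) `p ↦ Ah k t φ Z p` complex
differentiable on `ball 0 R`; (ARH-maj) the (2.38)-type majorant `‖Ah k t φ Z p‖ ≤ A_a·e^{−R_a d_{k+1}(Z)}` UNIFORMLY on the ball; S25's located numerals `r₁ + 2·64·log 162 + 2 ≤ R_a`
(«κ sufficiently large»), `A_a e^{5r₁+1} K₀(64,8)·9·64 ≤ 1` («ε₁ sufficiently small», the Kotecký–Preiss condition), `κ ≤ r₁`, `e·9·64·K₀(64,8)²·A_a ≤ M_b` (the renewal (2.41) ⇒ (1.18)).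
* §1 `stepGenE_eq_locE` (rfl); ★★ `genFact_of_activityReading` ((ARH-fact) ⟹ (AR-fact) with `A k t φ X p := locE(Z ↦ Ah k t φ Z p)(X)`, `locE_congr`); ★★ `genHoloBound_of_activityReading`
  ((ARH-holo) + (ARH-maj) + numerals ⟹ (AR-holo) AND the ball bound `M_b e^{−κd_{k+1}(X)}` — S25 at the parameter space `Pot k`).
* §2 ★★★ `ne9_EA_objectsOfRecord₁₃_of_kernelStepRate_activityReadingNonexpansive` — K3's `h9` = module J63 §1 with `hGA`, `hA`, `hMbA` DISCHARGED from the activity reading; §3 ★★★ the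
  kernel-face socket `n22At_u3OfRecord₁₃_of_kernelStepRate_activityReadingNonexpansive` (dag-n27-c's `h22` row).
After this module the OLDER-TERM input of N22's ROAD 2 in the recursion currency reads: «the step's ACTIVITIES, as functions of the older-term family read into a weighted sup-norm
space, are holomorphic with the (2.38) majorant on a ball with a margin around the (1.18)-admissible families» (+ the reading's dominations) — the activity-level form of pub-balaban's
GAPS G-ne9p2-5; the passage to E^{(k+1)} ((2.13), p. 15, (2.39)–(2.41)) is a kernel theorem.

HONEST FRAMING (binding).  Count-neutral COMPOSITION of landed theorems by name; (ARH) is a HYPOTHESIS SHAPE on def-W1's generator (the cell's reading of [II] (2.14)–(2.15) p. 15 and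
(2.38) p. 20 for the activities as functions of the older terms AS INDEPENDENT VARIABLES — not printed as such; producer: node N10 ∕ NODE A on def-T's generator of record; inhabited by
every generator with activities ignoring `old` within the (2.38) majorant — A5, conditional content); the numerals are S25's located clauses (cell's O(1)'s, not print's); NO estimate of
Bałaban's is asserted beyond the tree's kernel theorems used by name; nothing of the record is constructed or claimed to meet the displayed inputs.  N22 is NOT discharged (typed 28∕28
· discharged 5∕27 UNCHANGED); K3⁸ OPEN and NOT claimed; NE9 is NOT IN PRINT for d = 4; no count claim; one finite 𝕋⁴ programme at fixed ε — R4 closes the CONDITIONAL rung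
`BalabanLadder.UV` only; NOTHING about the continuum limit, ℝ⁴, infinite volume, OS axioms, a mass gap or the Clay problem is proved or claimed.  References (TYPES only): [I] =
Bałaban, CMP 109 (1987) (0.23) p. 256, (1.18) p. 263, (2.12)–(2.13) p. 268, §5 p. 298; [II] = CMP 116 (1988) (1.41) p. 11, (2.9)–(2.15) pp. 14–15, (2.38) p. 20, (2.39)–(2.41) p. 21, p. 18;
Kotecký–Preiss, CMP 103 (1986) Thm p. 492, p. 493; King, CMP 102 (1986) Lemma 4.5 (4.38).
-/

noncomputable section

open Set Metric
open scoped BigOperators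

namespace YMDAG.N22.TermRecursion

open Literature.MathematicalPhysics.QuantumFieldTheory.Balaban1983to89
open Literature.MathematicalPhysics.QuantumFieldTheory.Balaban1983to89.T4Continuum (T4Family)
open Literature.MathematicalPhysics.QuantumFieldTheory.Balaban1983to89.T4OutputRate (Window)
open Literature.MathematicalPhysics.QuantumFieldTheory.Balaban1983to89.TreeLengthTorus (TPt TDom tsys torusTreeLen torusTreeLen_nonneg)
open Literature.MathematicalPhysics.QuantumFieldTheory.Balaban1983to89.TreeLengthTorusGeometry (TTouch tgeometry)
open Literature.MathematicalPhysics.QuantumFieldTheory.Balaban1983to89.B12TreeDecay (K₀ K₀_pos)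
open Literature.MathematicalPhysics.QuantumFieldTheory.Balaban1983to89.B13Resummation (locE locE_congr)
open Literature.MathematicalPhysics.QuantumFieldTheory.Balaban1983to89.Node00.Sect2 (domSys domCount CPair)
open Literature.MathematicalPhysics.QuantumFieldTheory.Balaban1983to89.Node00.W1
open Summit.QuantumFields.BalabanUV.T4Continuum.NE1p.DressedOutputAnalyticFaces (analytic_and_bounded_locE_param_torus)

/-! ## §1 The term-level analytic reading from an analytic reading of the activities (one generator on the family's torus `K`) -/
section Gen

variable (F : T4Family) {𝔸 : Type} {M : ℕ} {K : ℕ} (G : GenTower (F.P K) 𝔸 M)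
  (sp : (k : ℕ) → (domSys (F.P K) M (k + 1)).Dom → Set (CPair (F.P K) 𝔸)) (Adm : (k : ℕ) → OlderTerms (F.P K) 𝔸 M k → Prop)
  {Pot : ℕ → Type*} [∀ k, NormedAddCommGroup (Pot k)] [∀ k, NormedSpace ℂ (Pot k)]
  (ρ : (k : ℕ) → OlderTerms (F.P K) 𝔸 M k → Pot k) (Ah : (k : ℕ) → ℝ → CPair (F.P K) 𝔸 → (domSys (F.P K) M (k + 1)).Dom → Pot k → ℂ)

open Classical in
/-- (2.13) IS DEFINITIONAL on the family's torus: node00-def-W1's one-step map `(G k).E t old φ X` is the tree's Kotecký–Preiss literal `locE` (wall-touching incompatibility `TTouch`,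
footprints `Z ↦ Z.1`) of the step's activities `Z ↦ (G k).H t old φ Z` at `X` — `rfl` (`(F.P K).d = 4`, `tgeometry`'s fields). [folklore] -/
theorem stepGenE_eq_locE (k : ℕ) (t : ℂ) (old : OlderTerms (F.P K) 𝔸 M k) (φ : CPair (F.P K) 𝔸) (X : (domSys (F.P K) M (k + 1)).Dom) :
    (G k).E t old φ X = locE (TTouch (d := 4) (N := domCount (F.P K) M (k + 1))) (fun Z : (tsys 4 (domCount (F.P K) M (k + 1))).Dom => Z.1)
      (fun Z => (G k).H t old φ Z) X.1 := rfl

omit [∀ k, NormedAddCommGroup (Pot k)] [∀ k, NormedSpace ℂ (Pot k)] in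
open Classical in
/-- ★★ **(AR-fact) FROM AN ANALYTIC READING OF THE ACTIVITIES.**  If on the admissibility domain the step's ACTIVITIES read through `ρ k` —
`(G k).H t old φ Z = Ah k t φ Z (ρ k old)` for the polymers `Z ⊆ X` ((2.11): the activities localize inside `X`) — then so does the (2.13) term, with the READ TERM MAP
**`A k t φ X p := locE(Z ↦ Ah k t φ Z p)(X)`**: `(G k).E t old φ X = A k t φ X (ρ k old)` (`locE_congr`: E^{(k+1)}(X) reads the activities of the `Z ⊆ X` only). [folklore] -/
theorem genFact_of_activityReading {γ : ℝ}
    (hHA : ∀ (k : ℕ), ∀ t ∈ Ioc (0 : ℝ) γ, ∀ (old : OlderTerms (F.P K) 𝔸 M k), Adm k old → ∀ (X : (domSys (F.P K) M (k + 1)).Dom), ∀ φ ∈ sp k X,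
      ∀ (Z : (domSys (F.P K) M (k + 1)).Dom), Z.1 ⊆ X.1 → (G k).H ((t : ℝ) : ℂ) old φ Z = Ah k t φ Z (ρ k old)) :
    ∀ (k : ℕ), ∀ t ∈ Ioc (0 : ℝ) γ, ∀ (old : OlderTerms (F.P K) 𝔸 M k), Adm k old → ∀ (X : (domSys (F.P K) M (k + 1)).Dom), ∀ φ ∈ sp k X,
      (G k).E ((t : ℝ) : ℂ) old φ X = locE (TTouch (d := 4) (N := domCount (F.P K) M (k + 1))) (fun Z : (tsys 4 (domCount (F.P K) M (k + 1))).Dom => Z.1)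
        (fun Z => Ah k t φ Z (ρ k old)) X.1 := by
  intro k t ht old hold X φ hφ
  rw [stepGenE_eq_locE]
  exact locE_congr _ fun Z hZ => hHA k t ht old hold X φ hφ Z hZ

open Classical in
/-- ★★ **(AR-holo) AND THE BALL BOUND FROM AN ANALYTIC READING OF THE ACTIVITIES — [II] p. 15 «the activities in (2.13), and the whole sum E^{(k+1)}(X), are analytic
functions …» + (2.39)–(2.41) p. 21, BY NAME on the four-torus.**  If the read activities `p ↦ Ah k t φ Z p` (`Z ⊆ X`, `φ` in the space table, `t ∈ ]0, γ]`) are complex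
differentiable on `ball 0 R` with the (2.38)-type majorant `‖Ah k t φ Z p‖ ≤ A_a·e^{−R_a d_{k+1}(Z)}` there, under S25's located numerals (`r₁ + 2·64·log 162 + 2 ≤ R_a`,
`A_a e^{5r₁+1} K₀(64,8)·9·64 ≤ 1`) and `κ ≤ r₁`, `e·9·64·K₀(64,8)²·A_a ≤ M_b`: the read term map `p ↦ locE(Z ↦ Ah k t φ Z p)(X)` is complex differentiable on `ball 0 R` AND
bounded by `M_b·e^{−κ d_{k+1}(X)}` there — S25 `analytic_and_bounded_locE_param_torus` (Kotecký–Preiss holomorphy in a Banach parameter + the anchored cluster bound) at the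
parameter space `Pot k`.  These are the binders `hA`, `hMbA` of modules J58–J65. [folklore] -/
theorem genHoloBound_of_activityReading {γ κ R Aa Ra r₁ Mb : ℝ} (hAa : 0 ≤ Aa) (hr₁ : 0 ≤ r₁) (hrate : r₁ + 2 * (64 * Real.log 162) + 2 ≤ Ra)
    (hsmall : Aa * Real.exp (5 * r₁ + 1) * K₀ 64 8 * 9 * 64 ≤ 1) (hκ : κ ≤ r₁) (hrenew : Real.exp 1 * 9 * 64 * K₀ 64 8 ^ 2 * Aa ≤ Mb)
    (hAh : ∀ (k : ℕ), ∀ t ∈ Ioc (0 : ℝ) γ, ∀ (X : (domSys (F.P K) M (k + 1)).Dom), ∀ φ ∈ sp k X, ∀ (Z : (domSys (F.P K) M (k + 1)).Dom), Z.1 ⊆ X.1 →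
      DifferentiableOn ℂ (Ah k t φ Z) (ball 0 R))
    (hmaj : ∀ (k : ℕ), ∀ t ∈ Ioc (0 : ℝ) γ, ∀ (X : (domSys (F.P K) M (k + 1)).Dom), ∀ φ ∈ sp k X, ∀ (Z : (domSys (F.P K) M (k + 1)).Dom), Z.1 ⊆ X.1 →
      ∀ p ∈ ball (0 : Pot k) R, ‖Ah k t φ Z p‖ ≤ Aa * Real.exp (-(Ra * torusTreeLen Z.1))) :
    (∀ (k : ℕ), ∀ t ∈ Ioc (0 : ℝ) γ, ∀ (X : (domSys (F.P K) M (k + 1)).Dom), ∀ φ ∈ sp k X,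
      DifferentiableOn ℂ (fun p => locE (TTouch (d := 4) (N := domCount (F.P K) M (k + 1))) (fun Z : (tsys 4 (domCount (F.P K) M (k + 1))).Dom => Z.1)
        (fun Z => Ah k t φ Z p) X.1) (ball 0 R)) ∧
    ∀ (k : ℕ), ∀ t ∈ Ioc (0 : ℝ) γ, ∀ (X : (domSys (F.P K) M (k + 1)).Dom), ∀ φ ∈ sp k X, ∀ p ∈ ball (0 : Pot k) R,
      ‖locE (TTouch (d := 4) (N := domCount (F.P K) M (k + 1))) (fun Z : (tsys 4 (domCount (F.P K) M (k + 1))).Dom => Z.1) (fun Z => Ah k t φ Z p) X.1‖ ≤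
        Mb * Real.exp (-(κ * (domSys (F.P K) M (k + 1)).dj X)) := by
  have key : ∀ (k : ℕ), ∀ t ∈ Ioc (0 : ℝ) γ, ∀ (X : (domSys (F.P K) M (k + 1)).Dom), ∀ φ ∈ sp k X, _ := fun k t ht X φ hφ =>
    analytic_and_bounded_locE_param_torus (N := domCount (F.P K) M (k + 1)) (P := Pot k)
      (m := fun Z : (tsys 4 (domCount (F.P K) M (k + 1))).Dom => Aa * Real.exp (-(Ra * torusTreeLen Z.1)))
      (act := fun p Z => Ah k t φ Z p) (A := Aa) (R := Ra) (r₁ := r₁) X isOpen_ball hAa hr₁ hrate hsmall (fun Z hZ => hAh k t ht X φ hφ Z hZ)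
      (fun p hp Z hZ => hmaj k t ht X φ hφ Z hZ p hp) (fun Z _ => le_rfl)
  have hM : 0 ≤ Real.exp 1 * 9 * 64 * K₀ 64 8 ^ 2 * Aa := by positivity
  refine ⟨fun k t ht X φ hφ => (key k t ht X φ hφ).1, fun k t ht X φ hφ p hp => ((key k t ht X φ hφ).2 p hp).trans ?_⟩
  show _ ≤ Mb * Real.exp (-(κ * torusTreeLen X.1))
  exact mul_le_mul hrenew (Real.exp_le_exp.2 (neg_le_neg (mul_le_mul_of_nonneg_right hκ (torusTreeLen_nonneg _)))) (Real.exp_nonneg _) (le_trans hM hrenew)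

end Gen

end YMDAG.N22.TermRecursion

namespace YMDAG.N22.KernelFading

open Literature.MathematicalPhysics.QuantumFieldTheory.Balaban1983to89
open Literature.MathematicalPhysics.QuantumFieldTheory.Balaban1983to89.T4Continuum (T4Family ULoop)
open Literature.MathematicalPhysics.QuantumFieldTheory.Balaban1983to89.T4OutputRate (Window NE9)
open Literature.MathematicalPhysics.QuantumFieldTheory.Balaban1983to89.TreeLengthTorus (TPt TDom tsys torusTreeLen)
open Literature.MathematicalPhysics.QuantumFieldTheory.Balaban1983to89.TreeLengthTorusGeometry (TTouch)
open Literature.MathematicalPhysics.QuantumFieldTheory.Balaban1983to89.B12TreeDecay (K₀ kappa₀)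
open Literature.MathematicalPhysics.QuantumFieldTheory.Balaban1983to89.B12Decay510 (delta1)
open Literature.MathematicalPhysics.QuantumFieldTheory.Balaban1983to89.B12Decay510Window (K₁)
open Literature.MathematicalPhysics.QuantumFieldTheory.Balaban1983to89.B12Decay510Torus (distCT nearT)
open Literature.MathematicalPhysics.QuantumFieldTheory.Balaban1983to89.B13Resummation (locE)
open Literature.MathematicalPhysics.QuantumFieldTheory.Balaban1983to89.Node00 (Stage13Params Stage13HParams U3Letters₁₁ MatA)
open Literature.MathematicalPhysics.QuantumFieldTheory.Balaban1983to89.Node00.Sect2 (domSys domCount CPair)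
open Literature.MathematicalPhysics.QuantumFieldTheory.Balaban1983to89.Node00.W1
open Literature.MathematicalPhysics.QuantumFieldTheory.Balaban1983to89.Node00.LocalizedSum17 (ReadingMaps Localizes17OfRecord₁₃)
open Literature.MathematicalPhysics.QuantumFieldTheory.Balaban1983to89.Node00.U3OfKernels (histPrefix objectsOfRecord₁₃)
open Literature.MathematicalPhysics.QuantumFieldTheory.Balaban1983to89.Node00.U3KernelLetters (KernelStepRateOfRecord₁₃ PolLimitsExistOfRecord₁₃)
open YMDAG.UVSplit (N22At u3OfRecord₁₃ RateReading₁₃CoPH rateCarriersOfRecord₁₃CoPH)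
open YMDAG.N22.AtKernels (n22At_u3OfRecord₁₃_objectsOfRecord₁₃_iff)
open YMDAG.N22.TermRecursion (genFact_of_activityReading genHoloBound_of_activityReading)

open scoped Matrix.Norms.L2Operator

variable (F : T4Family) (N : ℕ) [NeZero N] {𝔸 : Type} {M : ℕ}

/-! ## §2 ★★★ K3's `h9` on ROAD 2 with the term-level analyticity DISCHARGED from an analytic reading of the ACTIVITIES -/

open Classical Finset in
/-- ★★★ **K3's `h9` ON ROAD 2 FROM N18's KERNEL STEP RATE + AN ANALYTIC READING OF THE STEP's ACTIVITIES (the (2.11)∕(2.14) layer) — module J63 §1 with its term-level binders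
`hGA`, `hA`, `hMbA` DISCHARGED by §1** (Kotecký–Preiss holomorphy in a Banach parameter + the anchored cluster bound (2.39)–(2.41), BY NAME on the four-torus, S25).  Inputs:
N18's `KernelStepRateOfRecord₁₃`; per torus and step a reading `ρA K k` of the older-term families into `Pot K k` and READ ACTIVITIES `Ah K k t φ Z : Pot K k → ℂ` with
(ARH-fact) `((Gn K) k).H t old φ Z = Ah K k t φ Z (ρA K k old)` on `Adm K k` for `Z ⊆ X`, (ARH-holo) `Ah K k t φ Z` complex differentiable on `ball 0 R`, (ARH-maj) the (2.38)-type
majorant `‖Ah K k t φ Z p‖ ≤ A_a·e^{−R_a d_{k+1}(Z)}` on the ball, S25's located numerals (`r₁ + 2·64·log 162 + 2 ≤ R_a`, `A_a e^{5r₁+1}K₀(64,8)·9·64 ≤ 1`, `κ_E ≤ r₁`,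
`e·9·64·K₀(64,8)²A_a ≤ M_b`); (AR-adm)∕(AR-dom₁∕₂) for `ρA` with uniform age weights and the non-expansive margin `4M_b c_w∕ϱ < 1`; sector analyticity in the last coupling;
(Adm-run); readings ∕ tails ∕ law ∕ (1.21); the letter block's standing rows ⟹ **`NE9 ((objectsOfRecord₁₃ F N θ ℓ).EA 0) (Window θ.γ) ℓ.κ ℓ.moduli`**.  LOCATED (hypothesis form:
(ARH) is the cell's reading of [II] (2.14)–(2.15) p. 15 ∕ (2.38) p. 20 for the activities as functions of the older terms read into a Banach space — GAPS G-ne9p2-5 one layer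
down; the passage activities ⟹ E^{(k+1)} is print's own sentence p. 15 + (2.39)–(2.41), here a kernel theorem); N22 NOT discharged. [folklore] -/
theorem ne9_EA_objectsOfRecord₁₃_of_kernelStepRate_activityReadingNonexpansive (θ : Stage13Params F N) (ℓ : U3Letters₁₁) (hs : ℓ.Signs) (hγ : 0 < θ.γ)
    (hlim : PolLimitsExistOfRecord₁₃ F N θ) {κ₅ C₅ : ℝ} (hC₅ : 0 ≤ C₅) (h5 : KernelStepRateOfRecord₁₃ F N θ κ₅ ℓ.θ₅ C₅)
    (m' : ℕ) (M : ℕ) [NeZero M] (hM : M = F.L ^ m')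
    (Gn : (K : ℕ) → GenTower (F.P K) 𝔸 M) (emb : ReadingMaps F (MatA N) 𝔸)
    (hloc : Localizes17OfRecord₁₃ F N θ (fun K => truncRun K (toClusterTower (Gn K))) emb)
    (sp : (K k : ℕ) → (domSys (F.P K) M (k + 1)).Dom → Set (CPair (F.P K) 𝔸))
    {κ κE δ₀ B₃ r R r₀ ϱ Mb cw cS Bq Aa Ra r₁ : ℝ} {aw : ℕ → ℕ → ℕ → ℝ}
    (hκ₀ : kappa₀ (4 * 2 ^ 4) (2 * 4) ≤ κ / 2) (hδ₀ : 0 < δ₀) (hB₃ : 0 ≤ B₃) (hr : 0 < r) (hκE : κ ≤ κE)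
    (Adm : (K k : ℕ) → OlderTerms (F.P K) 𝔸 M k → Prop)
    (hAdm : ∀ K, ∀ g ∈ Window θ.γ, ∀ k, Adm K k (olderOf (recTerm (Gn K) fun n => ((g n : ℝ) : ℂ)) k))
    {Pot : ℕ → ℕ → Type*} [∀ K k, NormedAddCommGroup (Pot K k)] [∀ K k, NormedSpace ℂ (Pot K k)]
    (ρA : (K k : ℕ) → OlderTerms (F.P K) 𝔸 M k → Pot K k) (Ah : (K k : ℕ) → ℝ → CPair (F.P K) 𝔸 → (domSys (F.P K) M (k + 1)).Dom → Pot K k → ℂ)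
    (hHA : ∀ (K k : ℕ), ∀ t ∈ Ioc (0 : ℝ) θ.γ, ∀ (old : OlderTerms (F.P K) 𝔸 M k), Adm K k old → ∀ (X : (domSys (F.P K) M (k + 1)).Dom), ∀ φ ∈ sp K k X,
      ∀ (Z : (domSys (F.P K) M (k + 1)).Dom), Z.1 ⊆ X.1 → ((Gn K) k).H ((t : ℝ) : ℂ) old φ Z = Ah K k t φ Z (ρA K k old))
    (hAh : ∀ (K k : ℕ), ∀ t ∈ Ioc (0 : ℝ) θ.γ, ∀ (X : (domSys (F.P K) M (k + 1)).Dom), ∀ φ ∈ sp K k X, ∀ (Z : (domSys (F.P K) M (k + 1)).Dom), Z.1 ⊆ X.1 →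
      DifferentiableOn ℂ (Ah K k t φ Z) (ball 0 R))
    (hmaj : ∀ (K k : ℕ), ∀ t ∈ Ioc (0 : ℝ) θ.γ, ∀ (X : (domSys (F.P K) M (k + 1)).Dom), ∀ φ ∈ sp K k X, ∀ (Z : (domSys (F.P K) M (k + 1)).Dom), Z.1 ⊆ X.1 →
      ∀ p ∈ ball (0 : Pot K k) R, ‖Ah K k t φ Z p‖ ≤ Aa * Real.exp (-(Ra * torusTreeLen Z.1)))
    (hAa : 0 ≤ Aa) (hr₁ : 0 ≤ r₁) (hrate : r₁ + 2 * (64 * Real.log 162) + 2 ≤ Ra) (hsmall : Aa * Real.exp (5 * r₁ + 1) * K₀ 64 8 * 9 * 64 ≤ 1) (hκr : κE ≤ r₁)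
    (hrenew : Real.exp 1 * 9 * 64 * K₀ 64 8 ^ 2 * Aa ≤ Mb)
    (hAdmr : ∀ (K k : ℕ) (old : OlderTerms (F.P K) 𝔸 M k), Adm K k old → ‖ρA K k old‖ ≤ r₀)
    (hρ₁ : ∀ (K k : ℕ) (o o' : OlderTerms (F.P K) 𝔸 M k), Adm K k o → Adm K k o' → ∀ (B' : ℝ), 0 ≤ B' →
      (∀ (k' : ℕ) (hk' : k' < k) (Y : (domSys (F.P K) M (k' + 1)).Dom), ∀ φ' ∈ sp K k' Y,
        aw K k (k' + 1) * (Real.exp (κE * (domSys (F.P K) M (k' + 1)).dj Y) * ‖o ⟨k' + 1, Nat.succ_lt_succ hk'⟩ Y φ' - o' ⟨k' + 1, Nat.succ_lt_succ hk'⟩ Y φ'‖) ≤ B') →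
      ‖ρA K k o - ρA K k o'‖ ≤ B')
    (hρ₂ : ∀ (K k : ℕ) (o₁ o₂ o₃ : OlderTerms (F.P K) 𝔸 M k), Adm K k o₁ → Adm K k o₂ → Adm K k o₃ → ∀ (B' : ℝ), 0 ≤ B' →
      (∀ (k' : ℕ) (hk' : k' < k) (Y : (domSys (F.P K) M (k' + 1)).Dom), ∀ φ' ∈ sp K k' Y,
        aw K k (k' + 1) * (Real.exp (κE * (domSys (F.P K) M (k' + 1)).dj Y) *
          ‖o₁ ⟨k' + 1, Nat.succ_lt_succ hk'⟩ Y φ' - 2 * o₂ ⟨k' + 1, Nat.succ_lt_succ hk'⟩ Y φ' + o₃ ⟨k' + 1, Nat.succ_lt_succ hk'⟩ Y φ'‖) ≤ B') →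
      ‖ρA K k o₁ - (2 : ℂ) • ρA K k o₂ + ρA K k o₃‖ ≤ B')
    (haw : ∀ K k j, 0 ≤ aw K k j) (hawcw : ∀ K k j, aw K k j ≤ cw) (hC1 : 4 * Mb * cw / ϱ < 1)
    (hMb0 : 0 ≤ Mb) (hϱ : 0 < ϱ) (hR : r₀ + ϱ < R)
    (O : ℕ → Set ℂ) (V : (K k : ℕ) → OlderTerms (F.P K) 𝔸 M k → CPair (F.P K) 𝔸 → (domSys (F.P K) M (k + 1)).Dom → ℂ) (hcS : 0 < cS) (hBq : 0 ≤ Bq)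
    (hballS : ∀ K, ∀ s ∈ Ioc (0 : ℝ) θ.γ, closedBall (s : ℂ) (cS * s) ⊆ O K)
    (hholS : ∀ (K k : ℕ) (old : OlderTerms (F.P K) 𝔸 M k), Adm K k old → ∀ (X : (domSys (F.P K) M (k + 1)).Dom), ∀ φ ∈ sp K k X,
      DifferentiableOn ℂ (fun z => ((Gn K) k).E z old φ X) (O K))
    (hbdS : ∀ (K k : ℕ) (old : OlderTerms (F.P K) 𝔸 M k), Adm K k old → ∀ (X : (domSys (F.P K) M (k + 1)).Dom), ∀ φ ∈ sp K k X, ∀ s ∈ Ioc (0 : ℝ) θ.γ,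
      ∀ z ∈ closedBall (s : ℂ) (cS * s), ‖((Gn K) k).E z old φ X - V K k old φ X‖ ≤ Bq * Real.exp (-(κE * (domSys (F.P K) M (k + 1)).dj X)) * s ^ 2)
    (Ec : ℕ → ℕ → Type*) [∀ K k, NormedAddCommGroup (Ec K k)] [∀ K k, NormedSpace ℂ (Ec K k)]
    (ι : letI := θ.instVβ₁; letI := θ.instVβ₂
      (K k : ℕ) → (domSys (F.P K) M (k + 1)).Dom → ((Fin (F.P K).d → Site (F.P K) (k + 1) → θ.Vβ) →L[ℝ] Ec K k))
    (Φ : (K k : ℕ) → (domSys (F.P K) M (k + 1)).Dom → Ec K k → CPair (F.P K) 𝔸)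
    (U : (K k : ℕ) → (domSys (F.P K) M (k + 1)).Dom → Set (Ec K k)) (hU : ∀ K k X, IsOpen (U K k X)) (hrU : ∀ K k X, ball (0 : Ec K k) r ⊆ U K k X)
    (hEhol : ∀ g ∈ Window θ.γ, ∀ (K k : ℕ) (X : (domSys (F.P K) M (k + 1)).Dom),
      DifferentiableOn ℂ (fun z => (truncRun K (toClusterTower (Gn K)) k).E (histPrefix g k) (Φ K k X z) X) (U K k X))
    (hΦemb : letI := θ.instVβ₁; letI := θ.instVβ₂
      ∀ (K k : ℕ) (X : (domSys (F.P K) M (k + 1)).Dom) (Bf : Fin (F.P K).d → Site (F.P K) (k + 1) → θ.Vβ),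
        Φ K k X (ι K k X Bf) = emb K k (fun l t => NormedSpace.exp (θ.ρ8 (Bf l t))))
    (hΦsp : ∀ (K k : ℕ) (X : (domSys (F.P K) M (k + 1)).Dom), ∀ z ∈ ball (0 : Ec K k) r, Φ K k X z ∈ sp K k X)
    (w : (K k : ℕ) → (domSys (F.P K) M (k + 1)).Dom → Site (F.P K) (k + 1) → ℝ) (hw₀ : ∀ K k X t, 0 ≤ w K k X t)
    (hw : letI := θ.instVβ₁; letI := θ.instVβ₂; letI := θ.instιβ
      ∀ (K k : ℕ) (X : (domSys (F.P K) M (k + 1)).Dom) (l : Fin (F.P K).d) (t : Site (F.P K) (k + 1)) (c : θ.ιβ),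
        ‖ι K k X (Pi.single l (Pi.single t (θ.bV c)))‖ ≤ w K k X t)
    (htail : ∀ (K k : ℕ) (X : (domSys (F.P K) M (k + 1)).Dom) (t : Site (F.P K) (k + 1)),
      let e : Site (F.P K) (k + 1) → TPt 4 (domCount (F.P K) M (k + 1) * M) := fun x i => (ZMod.cast (x i) : ZMod (domCount (F.P K) M (k + 1) * M))
      w K k X t ≤ B₃ * Real.exp (-δ₀ * distCT (domCount (F.P K) M (k + 1)) M (e t) (nearT (M := M) (e t) X)))
    (hκ₅ : delta1 δ₀ κ ((M : ℝ) * 4) ≤ κ₅)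
    (hω : 0 < ℓ.ω) (hθω : ℓ.θ₅ ≤ ℓ.ω ^ 2) (hℓκ : ℓ.κ ≤ delta1 δ₀ κ ((M : ℝ) * 4))
    (hC₉ : (4 * (2 * C₅ / (1 - ℓ.θ₅) + 2 * ((16 * Mb * B₃ ^ 2 / r ^ 2) * Real.exp (delta1 δ₀ κ ((M : ℝ) * 4) * ((M : ℝ) * 4) * 3) * K₀ (4 * 2 ^ 4) (2 * 4) * K₁ 4 (δ₀ / 2))) / θ.γ +
        ((16 * max ((6 * cS ^ 2 + 32 * cS + 64) / cS ^ 2 * Bq) (64 * Mb * cw ^ 2 / ϱ ^ 2 * (Bq * θ.γ / cS) ^ 2 / (1 - 4 * Mb * cw / ϱ)) * B₃ ^ 2 / r ^ 2) * Real.exp (delta1 δ₀ κ ((M : ℝ) * 4) * ((M : ℝ) * 4) * 3) * K₀ (4 * 2 ^ 4) (2 * 4) *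
          K₁ 4 (δ₀ / 2)) * θ.γ / 2) / ℓ.ω ≤ ℓ.C₉) :
    NE9 ((objectsOfRecord₁₃ F N θ ℓ).EA 0) (Window θ.γ) ℓ.κ ℓ.moduli :=
  ne9_EA_objectsOfRecord₁₃_of_kernelStepRate_genAnalyticNonexpansive F N θ ℓ hs hγ hlim hC₅ h5 m' M hM Gn emb hloc sp hκ₀ hδ₀ hB₃ hr hκE Adm hAdm ρA
      (fun K k t φ X p => locE (TTouch (d := 4) (N := domCount (F.P K) M (k + 1))) (fun Z : (tsys 4 (domCount (F.P K) M (k + 1))).Dom => Z.1) (fun Z => Ah K k t φ Z p) X.1)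
      (fun K => genFact_of_activityReading F (Gn K) (sp K) (Adm K) (ρA K) (Ah K) (hHA K))
      (fun K => (genHoloBound_of_activityReading F (sp K) (Ah K) hAa hr₁ hrate hsmall hκr hrenew (hAh K) (hmaj K)).1)
      (fun K => (genHoloBound_of_activityReading F (sp K) (Ah K) hAa hr₁ hrate hsmall hκr hrenew (hAh K) (hmaj K)).2)
      hAdmr hρ₁ hρ₂ haw hawcw hC1 hMb0 hϱ hR O V hcS hBq hballS hholS hbdS Ec ι Φ U hU hrU hEhol hΦemb hΦsp w hw₀ hw htail hκ₅ hω hθω hℓκ hC₉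

/-! ## §3 ★★★ The kernel-face socket -/

open Classical Finset in
/-- ★★★ **THE KERNEL-FACE SOCKET WITH THE TERM-LEVEL ANALYTICITY DISCHARGED FROM THE ACTIVITIES** — §2's inputs ⟹ **`N22At (u3OfRecord₁₃ θ (objectsOfRecord₁₃ F N θ ℓ) k)` for
EVERY run length `k`** (dag-n27-c's `h22` row).  LOCATED (hypothesis form); N22 NOT discharged. [folklore] -/
theorem n22At_u3OfRecord₁₃_of_kernelStepRate_activityReadingNonexpansive (θ : Stage13Params F N) (ℓ : U3Letters₁₁) (hs : ℓ.Signs) (hγ : 0 < θ.γ)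
    (hlim : PolLimitsExistOfRecord₁₃ F N θ) {κ₅ C₅ : ℝ} (hC₅ : 0 ≤ C₅) (h5 : KernelStepRateOfRecord₁₃ F N θ κ₅ ℓ.θ₅ C₅)
    (m' : ℕ) (M : ℕ) [NeZero M] (hM : M = F.L ^ m')
    (Gn : (K : ℕ) → GenTower (F.P K) 𝔸 M) (emb : ReadingMaps F (MatA N) 𝔸)
    (hloc : Localizes17OfRecord₁₃ F N θ (fun K => truncRun K (toClusterTower (Gn K))) emb)
    (sp : (K k : ℕ) → (domSys (F.P K) M (k + 1)).Dom → Set (CPair (F.P K) 𝔸))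
    {κ κE δ₀ B₃ r R r₀ ϱ Mb cw cS Bq Aa Ra r₁ : ℝ} {aw : ℕ → ℕ → ℕ → ℝ}
    (hκ₀ : kappa₀ (4 * 2 ^ 4) (2 * 4) ≤ κ / 2) (hδ₀ : 0 < δ₀) (hB₃ : 0 ≤ B₃) (hr : 0 < r) (hκE : κ ≤ κE)
    (Adm : (K k : ℕ) → OlderTerms (F.P K) 𝔸 M k → Prop)
    (hAdm : ∀ K, ∀ g ∈ Window θ.γ, ∀ k, Adm K k (olderOf (recTerm (Gn K) fun n => ((g n : ℝ) : ℂ)) k))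
    {Pot : ℕ → ℕ → Type*} [∀ K k, NormedAddCommGroup (Pot K k)] [∀ K k, NormedSpace ℂ (Pot K k)]
    (ρA : (K k : ℕ) → OlderTerms (F.P K) 𝔸 M k → Pot K k) (Ah : (K k : ℕ) → ℝ → CPair (F.P K) 𝔸 → (domSys (F.P K) M (k + 1)).Dom → Pot K k → ℂ)
    (hHA : ∀ (K k : ℕ), ∀ t ∈ Ioc (0 : ℝ) θ.γ, ∀ (old : OlderTerms (F.P K) 𝔸 M k), Adm K k old → ∀ (X : (domSys (F.P K) M (k + 1)).Dom), ∀ φ ∈ sp K k X,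
      ∀ (Z : (domSys (F.P K) M (k + 1)).Dom), Z.1 ⊆ X.1 → ((Gn K) k).H ((t : ℝ) : ℂ) old φ Z = Ah K k t φ Z (ρA K k old))
    (hAh : ∀ (K k : ℕ), ∀ t ∈ Ioc (0 : ℝ) θ.γ, ∀ (X : (domSys (F.P K) M (k + 1)).Dom), ∀ φ ∈ sp K k X, ∀ (Z : (domSys (F.P K) M (k + 1)).Dom), Z.1 ⊆ X.1 →
      DifferentiableOn ℂ (Ah K k t φ Z) (ball 0 R))
    (hmaj : ∀ (K k : ℕ), ∀ t ∈ Ioc (0 : ℝ) θ.γ, ∀ (X : (domSys (F.P K) M (k + 1)).Dom), ∀ φ ∈ sp K k X, ∀ (Z : (domSys (F.P K) M (k + 1)).Dom), Z.1 ⊆ X.1 →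
      ∀ p ∈ ball (0 : Pot K k) R, ‖Ah K k t φ Z p‖ ≤ Aa * Real.exp (-(Ra * torusTreeLen Z.1)))
    (hAa : 0 ≤ Aa) (hr₁ : 0 ≤ r₁) (hrate : r₁ + 2 * (64 * Real.log 162) + 2 ≤ Ra) (hsmall : Aa * Real.exp (5 * r₁ + 1) * K₀ 64 8 * 9 * 64 ≤ 1) (hκr : κE ≤ r₁)
    (hrenew : Real.exp 1 * 9 * 64 * K₀ 64 8 ^ 2 * Aa ≤ Mb)
    (hAdmr : ∀ (K k : ℕ) (old : OlderTerms (F.P K) 𝔸 M k), Adm K k old → ‖ρA K k old‖ ≤ r₀)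
    (hρ₁ : ∀ (K k : ℕ) (o o' : OlderTerms (F.P K) 𝔸 M k), Adm K k o → Adm K k o' → ∀ (B' : ℝ), 0 ≤ B' →
      (∀ (k' : ℕ) (hk' : k' < k) (Y : (domSys (F.P K) M (k' + 1)).Dom), ∀ φ' ∈ sp K k' Y,
        aw K k (k' + 1) * (Real.exp (κE * (domSys (F.P K) M (k' + 1)).dj Y) * ‖o ⟨k' + 1, Nat.succ_lt_succ hk'⟩ Y φ' - o' ⟨k' + 1, Nat.succ_lt_succ hk'⟩ Y φ'‖) ≤ B') →
      ‖ρA K k o - ρA K k o'‖ ≤ B')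
    (hρ₂ : ∀ (K k : ℕ) (o₁ o₂ o₃ : OlderTerms (F.P K) 𝔸 M k), Adm K k o₁ → Adm K k o₂ → Adm K k o₃ → ∀ (B' : ℝ), 0 ≤ B' →
      (∀ (k' : ℕ) (hk' : k' < k) (Y : (domSys (F.P K) M (k' + 1)).Dom), ∀ φ' ∈ sp K k' Y,
        aw K k (k' + 1) * (Real.exp (κE * (domSys (F.P K) M (k' + 1)).dj Y) *
          ‖o₁ ⟨k' + 1, Nat.succ_lt_succ hk'⟩ Y φ' - 2 * o₂ ⟨k' + 1, Nat.succ_lt_succ hk'⟩ Y φ' + o₃ ⟨k' + 1, Nat.succ_lt_succ hk'⟩ Y φ'‖) ≤ B') →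
      ‖ρA K k o₁ - (2 : ℂ) • ρA K k o₂ + ρA K k o₃‖ ≤ B')
    (haw : ∀ K k j, 0 ≤ aw K k j) (hawcw : ∀ K k j, aw K k j ≤ cw) (hC1 : 4 * Mb * cw / ϱ < 1)
    (hMb0 : 0 ≤ Mb) (hϱ : 0 < ϱ) (hR : r₀ + ϱ < R)
    (O : ℕ → Set ℂ) (V : (K k : ℕ) → OlderTerms (F.P K) 𝔸 M k → CPair (F.P K) 𝔸 → (domSys (F.P K) M (k + 1)).Dom → ℂ) (hcS : 0 < cS) (hBq : 0 ≤ Bq)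
    (hballS : ∀ K, ∀ s ∈ Ioc (0 : ℝ) θ.γ, closedBall (s : ℂ) (cS * s) ⊆ O K)
    (hholS : ∀ (K k : ℕ) (old : OlderTerms (F.P K) 𝔸 M k), Adm K k old → ∀ (X : (domSys (F.P K) M (k + 1)).Dom), ∀ φ ∈ sp K k X,
      DifferentiableOn ℂ (fun z => ((Gn K) k).E z old φ X) (O K))
    (hbdS : ∀ (K k : ℕ) (old : OlderTerms (F.P K) 𝔸 M k), Adm K k old → ∀ (X : (domSys (F.P K) M (k + 1)).Dom), ∀ φ ∈ sp K k X, ∀ s ∈ Ioc (0 : ℝ) θ.γ,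
      ∀ z ∈ closedBall (s : ℂ) (cS * s), ‖((Gn K) k).E z old φ X - V K k old φ X‖ ≤ Bq * Real.exp (-(κE * (domSys (F.P K) M (k + 1)).dj X)) * s ^ 2)
    (Ec : ℕ → ℕ → Type*) [∀ K k, NormedAddCommGroup (Ec K k)] [∀ K k, NormedSpace ℂ (Ec K k)]
    (ι : letI := θ.instVβ₁; letI := θ.instVβ₂
      (K k : ℕ) → (domSys (F.P K) M (k + 1)).Dom → ((Fin (F.P K).d → Site (F.P K) (k + 1) → θ.Vβ) →L[ℝ] Ec K k))
    (Φ : (K k : ℕ) → (domSys (F.P K) M (k + 1)).Dom → Ec K k → CPair (F.P K) 𝔸)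
    (U : (K k : ℕ) → (domSys (F.P K) M (k + 1)).Dom → Set (Ec K k)) (hU : ∀ K k X, IsOpen (U K k X)) (hrU : ∀ K k X, ball (0 : Ec K k) r ⊆ U K k X)
    (hEhol : ∀ g ∈ Window θ.γ, ∀ (K k : ℕ) (X : (domSys (F.P K) M (k + 1)).Dom),
      DifferentiableOn ℂ (fun z => (truncRun K (toClusterTower (Gn K)) k).E (histPrefix g k) (Φ K k X z) X) (U K k X))
    (hΦemb : letI := θ.instVβ₁; letI := θ.instVβ₂
      ∀ (K k : ℕ) (X : (domSys (F.P K) M (k + 1)).Dom) (Bf : Fin (F.P K).d → Site (F.P K) (k + 1) → θ.Vβ),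
        Φ K k X (ι K k X Bf) = emb K k (fun l t => NormedSpace.exp (θ.ρ8 (Bf l t))))
    (hΦsp : ∀ (K k : ℕ) (X : (domSys (F.P K) M (k + 1)).Dom), ∀ z ∈ ball (0 : Ec K k) r, Φ K k X z ∈ sp K k X)
    (w : (K k : ℕ) → (domSys (F.P K) M (k + 1)).Dom → Site (F.P K) (k + 1) → ℝ) (hw₀ : ∀ K k X t, 0 ≤ w K k X t)
    (hw : letI := θ.instVβ₁; letI := θ.instVβ₂; letI := θ.instιβ
      ∀ (K k : ℕ) (X : (domSys (F.P K) M (k + 1)).Dom) (l : Fin (F.P K).d) (t : Site (F.P K) (k + 1)) (c : θ.ιβ),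
        ‖ι K k X (Pi.single l (Pi.single t (θ.bV c)))‖ ≤ w K k X t)
    (htail : ∀ (K k : ℕ) (X : (domSys (F.P K) M (k + 1)).Dom) (t : Site (F.P K) (k + 1)),
      let e : Site (F.P K) (k + 1) → TPt 4 (domCount (F.P K) M (k + 1) * M) := fun x i => (ZMod.cast (x i) : ZMod (domCount (F.P K) M (k + 1) * M))
      w K k X t ≤ B₃ * Real.exp (-δ₀ * distCT (domCount (F.P K) M (k + 1)) M (e t) (nearT (M := M) (e t) X)))
    (hκ₅ : delta1 δ₀ κ ((M : ℝ) * 4) ≤ κ₅)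
    (hω : 0 < ℓ.ω) (hθω : ℓ.θ₅ ≤ ℓ.ω ^ 2) (hℓκ : ℓ.κ ≤ delta1 δ₀ κ ((M : ℝ) * 4))
    (hC₉ : (4 * (2 * C₅ / (1 - ℓ.θ₅) + 2 * ((16 * Mb * B₃ ^ 2 / r ^ 2) * Real.exp (delta1 δ₀ κ ((M : ℝ) * 4) * ((M : ℝ) * 4) * 3) * K₀ (4 * 2 ^ 4) (2 * 4) * K₁ 4 (δ₀ / 2))) / θ.γ +
        ((16 * max ((6 * cS ^ 2 + 32 * cS + 64) / cS ^ 2 * Bq) (64 * Mb * cw ^ 2 / ϱ ^ 2 * (Bq * θ.γ / cS) ^ 2 / (1 - 4 * Mb * cw / ϱ)) * B₃ ^ 2 / r ^ 2) * Real.exp (delta1 δ₀ κ ((M : ℝ) * 4) * ((M : ℝ) * 4) * 3) * K₀ (4 * 2 ^ 4) (2 * 4) *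
          K₁ 4 (δ₀ / 2)) * θ.γ / 2) / ℓ.ω ≤ ℓ.C₉) (k : ℕ) :
    N22At (u3OfRecord₁₃ θ (objectsOfRecord₁₃ F N θ ℓ) k) :=
  (n22At_u3OfRecord₁₃_objectsOfRecord₁₃_iff F N θ ℓ hs k).2
    (ne9_EA_objectsOfRecord₁₃_of_kernelStepRate_genAnalyticNonexpansive F N θ ℓ hs hγ hlim hC₅ h5 m' M hM Gn emb hloc sp hκ₀ hδ₀ hB₃ hr hκE Adm hAdm ρA
      (fun K k t φ X p => locE (TTouch (d := 4) (N := domCount (F.P K) M (k + 1))) (fun Z : (tsys 4 (domCount (F.P K) M (k + 1))).Dom => Z.1) (fun Z => Ah K k t φ Z p) X.1)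
      (fun K => genFact_of_activityReading F (Gn K) (sp K) (Adm K) (ρA K) (Ah K) (hHA K))
      (fun K => (genHoloBound_of_activityReading F (sp K) (Ah K) hAa hr₁ hrate hsmall hκr hrenew (hAh K) (hmaj K)).1)
      (fun K => (genHoloBound_of_activityReading F (sp K) (Ah K) hAa hr₁ hrate hsmall hκr hrenew (hAh K) (hmaj K)).2)
      hAdmr hρ₁ hρ₂ haw hawcw hC1 hMb0 hϱ hR O V hcS hBq hballS hholS hbdS Ec ι Φ U hU hrU hEhol hΦemb hΦsp w hw₀ hw htail hκ₅ hω hθω hℓκ hC₉)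

end YMDAG.N22.KernelFading

end
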